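import Literature.Computability.Complexity.UniversalStep
import HarnessLib

/-!
# The universal step: time overhead of flat runs and growth of the codes

Quantitative companion of `FlatPrograms.lean` (standard machine `c : TM2Std.SCode` ↦ flat
program `FlatProg.compile c`, one machine step = a positive number `≤ FlatProg.haltAddr c` of flat
steps, `FlatProg.runsB_step`) and `UniversalStep.lean` (the universal step
`UnivStep.ustepFn ∈ FP` on string codes `UnivStep.enc P cfg = ⟨P, ⟨pc, stacks⟩⟩`, correct along
flat runs), supplying the two estimates a CLOCKED universal machine needs (Arora–Barak 2009,
§1.4.1 "Universal TM with time bound", Thm. 1.9: `T` steps of `M` cost `C_M · T` steps of the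
relaxed universal machine, and the simulation only ever handles configurations of size linear in
the elapsed time):

* (the **time overhead** — `t` steps of the standard machine are matched by at most
  `t · haltAddr c` flat steps — is `FlatProg.exists_iterate_le_of_iterate` of `FlatRuns.lean`;
  here only:) `FlatProg.iterate_eq_of_halted` — a run that has reached a halted flat
  configuration stays there;
* `UnivStep.length_enc_step_le` — **growth**: one flat step lengthens the code by at most
  `6 (|encProg P| + 1)` symbols (the new program counter and the pushed symbol are copied out of
  the program; `UnivStep.length_encStacks_set`), for EVERY program and configuration (no
  well-formedness needed);
* `UnivStep.insF_enc_eq_nil_iff` — the fetched-instruction field of a code is empty iff the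
  configuration is halted;
* the string form of initial stack contents: with the input symbols coded `0`/`1`, the coded
  input stack is a fixed letter-to-word substitution `UnivStep.encInput` of the input word
  (`UnivStep.dbl_encStack_map_code01`), and the stacks field of an initial configuration is
  `nilStacks k₀ ++ encInput w ++ (01 :: nilStacks (nK - k₀ - 1))`
  (`UnivStep.encStacks_replicate_set`) — the shape in which ONE polynomial-time function,
  uniform in the machine, writes initial configurations (sequel
  `ClockedUniversalAcceptanceProofs.lean`).

## References

* S. Arora, B. Barak, *Computational Complexity: A Modern Approach*, CUP 2009, §1.4.1 (universal
  TM with time bound), Thm. 1.9 and its relaxed proof (overhead `C · T`), §1.4 (codes of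
  machines and configurations) [AroraBarakCC2009].
-/

namespace Literature.Computability.Complexity

/-! ### Halted flat runs -/

namespace FlatProg

open Function

/-- **A halted flat configuration is final**: if the run reaches, after `n` steps, a
configuration whose program counter is past the end, it is there at every later time. [folklore] -/
theorem iterate_eq_of_halted {P : Prog} {x y : Cfg} {n m : ℕ} (h : (step P)^[n] x = y)
    (hy : P.length ≤ y.1) (hm : n ≤ m) : (step P)^[m] x = y := by
  obtain ⟨d, rfl⟩ := Nat.exists_eq_add_of_le hm
  rw [Nat.add_comm, iterate_add_apply, h, iterate_step_of_le hy]

end FlatProg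

/-! ### Growth of the codes under the universal step -/

namespace UnivStep

open _root_.Computability Brick FlatProg

/-- An item of a coded list is at most as long as the coded list. [folklore] -/
theorem length_le_length_encList_of_mem {a : List Bool} {L : List (List Bool)} (h : a ∈ L) :
    a.length ≤ (encList L).length := by
  induction L with
  | nil => cases h
  | cons b L ih =>
    rw [encList_cons, length_boolPair]
    rcases List.mem_cons.1 h with rfl | h
    · omega
    · have := ih h; omega

/-- An instruction code is at most as long as the program code. [folklore] -/
theorem length_encInstr_le {P : Prog} {i : Instr} (h : i ∈ P) :
    (encInstr i).length ≤ (encProg P).length :=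
  length_le_length_encList_of_mem (List.mem_map.2 ⟨i, h, rfl⟩)

/-- The target of a `goto` is written inside its code. [folklore] -/
theorem length_bin_le_encInstr_goto (j : ℕ) : (bin j).length ≤ (encInstr (.goto j)).length := by
  simp only [encInstr, length_boolPair, List.length_nil]
  omega

/-- The pushed symbol and the target of a `push` are written inside its code. [folklore] -/
theorem length_bin_le_encInstr_push (k a j : ℕ) :
    (bin a).length ≤ (encInstr (.push k a j)).length ∧
      (bin j).length ≤ (encInstr (.push k a j)).length := by
  simp only [encInstr, length_boolPair, List.length_singleton]
  omega

/-- Every entry of the jump table of a `pop` (and the default `0`) is written inside its code.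
[folklore] -/
theorem length_bin_getD_le_encInstr_pop (k : ℕ) (t : List ℕ) (i : ℕ) :
    (bin (t.getD i 0)).length ≤ (encInstr (.pop k t)).length := by
  have h1 : (encTbl t).length ≤ (encInstr (.pop k t)).length := by
    simp only [encInstr, length_boolPair, List.length_singleton]
    omega
  refine le_trans ?_ h1
  rw [List.getD_eq_getElem?_getD]
  cases h : t[i]? with
  | none => exact Nat.zero_le _
  | some j =>
    exact length_le_length_encList_of_mem (List.mem_map.2 ⟨j, List.mem_of_getElem? h, rfl⟩)

/-- The coded stacks of a nonempty stack list. [folklore] -/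
theorem encStacks_cons (s : List ℕ) (S : List (List ℕ)) :
    encStacks (s :: S) = boolPair (encStack s) (encStacks S) := rfl

/-- The empty stack list. [folklore] -/
@[simp] theorem encStacks_nil : encStacks [] = [] := rfl

/-- Length of a pushed coded stack. [folklore] -/
theorem length_encStack_cons (a : ℕ) (s : List ℕ) :
    (encStack (a :: s)).length = 2 * (bin a).length + 2 + (encStack s).length := by
  rw [encStack_cons, length_boolPair]

/-- A popped coded stack is not longer. [folklore] -/
theorem length_encStack_tail_le (s : List ℕ) : (encStack s.tail).length ≤ (encStack s).length := by
  cases s with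
  | nil => exact le_rfl
  | cons a s => rw [List.tail_cons, length_encStack_cons]; omega

/-- **Writing one stack**: the length of the coded stacks changes by twice the change of the
written coded stack. [folklore] -/
theorem length_encStacks_set : ∀ (S : List (List ℕ)) (k : ℕ) (s : List ℕ), k < S.length →
    (encStacks (S.set k s)).length + 2 * (encStack (S.getD k [])).length =
      (encStacks S).length + 2 * (encStack s).length
  | [], _, _, hk => absurd hk (Nat.not_lt_zero _)
  | s₀ :: S, 0, s, _ => by
    simp only [List.set_cons_zero, List.getD_cons_zero, encStacks_cons, length_boolPair]
    omega
  | s₀ :: S, k + 1, s, hk => by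
    simp only [List.set_cons_succ, List.getD_cons_succ, encStacks_cons, length_boolPair]
    have := length_encStacks_set S k s (by simpa using hk)
    omega

/-- Length of a code. [folklore] -/
theorem length_enc (P : Prog) (pc : ℕ) (S : List (List ℕ)) :
    (enc P (pc, S)).length =
      2 * (encProg P).length + 2 * (bin pc).length + (encStacks S).length + 4 := by
  simp only [enc, encCfg, length_boolPair]
  omega

/-- Executing an instruction fetched from `P`: the stacks code grows by at most
`4 |encProg P| + 4`, and the new program counter is written inside the program code. [folklore] -/
theorem length_apply_le {P : Prog} {i : Instr} (hi : i ∈ P) (S : List (List ℕ)) :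
    (encStacks (i.apply S).2).length ≤ (encStacks S).length + 4 * (encProg P).length + 4 ∧
      (bin (i.apply S).1).length ≤ (encProg P).length := by
  have hP := length_encInstr_le hi
  cases i with
  | goto j => exact ⟨by simp only [Instr.apply]; omega, (length_bin_le_encInstr_goto j).trans hP⟩
  | push k a j =>
    obtain ⟨ha, hj⟩ := length_bin_le_encInstr_push k a j
    refine ⟨?_, hj.trans hP⟩
    simp only [Instr.apply]
    by_cases hk : k < S.length
    · rw [modify_cons_eq_set S hk]
      have h := length_encStacks_set S k (a :: S.getD k []) hk
      rw [length_encStack_cons] at h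
      omega
    · rw [List.modify_eq_self (not_lt.1 hk)]
      omega
  | pop k t =>
    refine ⟨?_, (length_bin_getD_le_encInstr_pop k t _).trans hP⟩
    simp only [Instr.apply]
    by_cases hk : k < S.length
    · have h := length_encStacks_set S k (S.getD k []).tail hk
      have h' := length_encStack_tail_le (S.getD k [])
      omega
    · rw [List.set_eq_of_length_le (not_lt.1 hk)]
      omega

/-- **Growth of the code under one flat step**: at most `6 (|encProg P| + 1)` symbols, for every
program and every configuration. [cite: AroraBarakCC2009, §1.4.1 (the clocked simulation handles configurations of size linear in the elapsed time)] -/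
theorem length_enc_step_le (P : Prog) (c : Cfg) :
    (enc P (step P c)).length ≤ (enc P c).length + 6 * ((encProg P).length + 1) := by
  obtain ⟨pc, S⟩ := c
  unfold step
  cases hP : P[pc]? with
  | none => exact Nat.le_add_right _ _
  | some i =>
    dsimp only
    have hi : i ∈ P := List.mem_of_getElem? hP
    obtain ⟨h1, h2⟩ := length_apply_le hi S
    have e : i.apply S = ((i.apply S).1, (i.apply S).2) := rfl
    rw [e, length_enc, length_enc]
    omega

/-- Growth along `n` flat steps. [folklore] -/
theorem length_enc_iterate_step_le (P : Prog) (c : Cfg) (n : ℕ) :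
    (enc P ((step P)^[n] c)).length ≤ (enc P c).length + n * (6 * ((encProg P).length + 1)) := by
  induction n with
  | zero => simp
  | succ n ih =>
    rw [Function.iterate_succ_apply', Nat.succ_mul]
    have := length_enc_step_le P ((step P)^[n] c)
    omega

/-- **The fetched-instruction field is empty iff the configuration is halted.** [folklore] -/
theorem insF_enc_eq_nil_iff (P : Prog) (c : Cfg) : insF (enc P c) = [] ↔ P.length ≤ c.1 := by
  obtain ⟨pc, S⟩ := c
  cases h : P[pc]? with
  | none => exact ⟨fun _ => List.getElem?_eq_none_iff.1 h, fun _ => insF_enc_of_none h⟩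
  | some i =>
    rw [insF_enc_of_some h]
    exact ⟨fun hi => absurd hi (encInstr_ne_nil i),
      fun hl => absurd (List.getElem?_eq_some_iff.1 h).1 (not_lt.2 hl)⟩

/-! ### Initial stack contents as strings -/

-- Bit doubling `SProg.dbl z = z.flatMap fun b => [b, b]` (the first component of `boolPair`) is
-- the tree's (`StackMachines.lean`, with `SProg.dbl_nil`, `SProg.dbl_cons`).
open SProg (dbl)

/-- `boolPair` spelled with `dbl`. [folklore] -/
theorem boolPair_eq_dbl (x y : List Bool) : boolPair x y = dbl x ++ [false, true] ++ y := rfl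

/-- `dbl` is a monoid homomorphism. [folklore] -/
@[simp] theorem dbl_append (x y : List Bool) : dbl (x ++ y) = dbl x ++ dbl y := by
  simp [SProg.dbl]

/-- Coded lists concatenate (the twin `FregeTransl.encList_append` of
`MetaComplexity/FregeTranslation.lean` is not imported into the `Complexity` layer). [folklore] -/
theorem encList_append (l₁ l₂ : List (List Bool)) : encList (l₁ ++ l₂) = encList l₁ ++ encList l₂ := by
  induction l₁ with
  | nil => rfl
  | cons a l ih => simp only [List.cons_append, encList_cons, ih, boolPair_eq_dbl, List.append_assoc]

/-- Coded stack lists concatenate. [folklore] -/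
theorem encStacks_append (S₁ S₂ : List (List ℕ)) :
    encStacks (S₁ ++ S₂) = encStacks S₁ ++ encStacks S₂ := by
  rw [encStacks, List.map_append, encList_append]; rfl

/-- The coded stacks of `m` empty stacks (`01` repeated `m` times). [folklore] -/
def nilStacks (m : ℕ) : List Bool := encStacks (List.replicate m [])

/-- **The input substitution**: with the input symbols coded `false ↦ 0`, `true ↦ 1`, an input
bit contributes the doubled code of `⟨bin 0, ·⟩ = 01…` resp. `⟨bin 1, ·⟩ = 1101…` to the
(doubled) coded input stack. [cite: AroraBarakCC2009, §1.4 (codes of configurations)] -/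
def inputHom (b : Bool) : List Bool :=
  if b then [true, true, true, true, false, false, true, true] else [false, false, true, true]

/-- The doubled coded input stack of an input word. [cite: AroraBarakCC2009, §1.4] -/
def encInput (w : List Bool) : List Bool := w.flatMap inputHom

/-- The numeric code of an input bit. [folklore] -/
def code01 (b : Bool) : ℕ := if b then 1 else 0

/-- `bin 1 = 1`. [folklore] -/
theorem bin_one : bin 1 = [true] := by decide

/-- **The doubled coded input stack is the input substitution of the input word.** [folklore] -/
theorem dbl_encStack_map_code01 (w : List Bool) : dbl (encStack (w.map code01)) = encInput w := by
  induction w with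
  | nil => rfl
  | cons b w ih =>
    rw [List.map_cons, encStack_cons, boolPair_eq_dbl, dbl_append, dbl_append, ih, encInput,
      encInput, List.flatMap_cons]
    cases b
    · rfl
    · rw [code01, if_pos rfl, bin_one]; rfl

/-- **The stacks field of an initial configuration**: `nK` stacks, all empty but stack `k₀`
which holds `s`, code to `nilStacks k₀ ++ dbl (encStack s) ++ 01 ++ nilStacks (nK - k₀ - 1)`.
[cite: AroraBarakCC2009, §1.4] -/
theorem encStacks_replicate_set {nK k₀ : ℕ} (hk : k₀ < nK) (s : List ℕ) :
    encStacks ((List.replicate nK ([] : List ℕ)).set k₀ s) =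
      nilStacks k₀ ++ (dbl (encStack s) ++ [false, true] ++ nilStacks (nK - k₀ - 1)) := by
  rw [List.set_eq_take_append_cons_drop, if_pos (by rw [List.length_replicate]; exact hk),
    List.take_replicate, min_eq_left hk.le, List.drop_replicate, encStacks_append, nilStacks,
    nilStacks, encStacks_cons, boolPair_eq_dbl, Nat.sub_sub]

end UnivStep

end Literature.Computability.Complexity
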